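import Summits.Ventures.Crystal3D.Theorems.StickyWulffConstantGenericWallFloorGeneralRung
import HarnessLib

/-!
# The general-filling rung modulo twin caps, under the stub's own non-co-axiality hypothesis

HONEST FRAMING. Part of the venture `Summits/Ventures/Crystal3D` (cell `crystal3d-full`), helper for the
crux `GenericWallFloor` (stmt-Ventures-19480) of `route-Ventures-StickyWulffConstant`, REGISTERED line
`WallLedgerG` (planner cf-p1 gen 16), stub `stub_twoSlabAdhesion : TwoSlabAdhesion` (THE CRUX of the line).
`general_twoSlabAdhesion_modulo_twinCaps` (`…GeneralRung`) assumed that the two grains have different slot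
sets; here that is DERIVED from the stub's hypothesis (the pair is not co-axial): the twelve slots generate the
lattice, so `A₁·(slots) ⊆ A₂·Λ₀` gives `A₁·Λ₀ ⊆ A₂·Λ₀`, and a common linear frame makes the pair co-axial
(`coaxial_of_subset_frame`).  Rung credit only; F-C1 not moved.

* `image_fcc_subset_of_slots_mem` — `(∀ w ∈ fccSlots, A₁ w ∈ A₂·Λ₀) → A₁·Λ₀ ⊆ A₂·Λ₀`;
* `slots_not_subset_of_not_coaxial` — the two slot-set hypotheses from non-co-axiality;
* `general_twoSlabAdhesion_modulo_twinCaps_of_not_coaxial` — the rung with the stub's hypothesis verbatim.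

WHAT THIS IS NOT: not the stub (charge `1/3770`, residual twin-capped exits, clean slivers); F-C1 not moved.
-/

noncomputable section

namespace Summit.Ventures.Crystal3D.Theorems

open Summit.Ventures.Crystal3D Finset
open Literature.MathematicalPhysics.StatisticalMechanics (fccStacking barlowStacking IsHaggSeq constHagg
  contactDeficiency isHaggSeq_const le_dist_of_mem_barlowStacking_ideal)
open Literature.Barriers.AtomisticToContinuum (barlowAddSubgroupOfConst)
open scoped InnerProductSpace

/-- **The slots generate the lattice**: if every slot vector of frame `A₁` lies in the linear lattice of frame
`A₂`, then so does the whole lattice `A₁·Λ₀`. -/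
theorem image_fcc_subset_of_slots_mem (A₁ A₂ : EuclideanSpace ℝ (Fin 3) ≃ₗᵢ[ℝ] EuclideanSpace ℝ (Fin 3))
    (h : ∀ w ∈ fccSlots, A₁ w ∈ A₂ '' fccStacking 1 (Real.sqrt (2 / 3))) :
    A₁ '' fccStacking 1 (Real.sqrt (2 / 3)) ⊆ A₂ '' fccStacking 1 (Real.sqrt (2 / 3)) := by
  classical
  set G : AddSubgroup (EuclideanSpace ℝ (Fin 3)) :=
    barlowAddSubgroupOfConst 1 (Real.sqrt (2 / 3)) constHagg (fun _ => rfl) with hG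
  have hGmem : ∀ w, w ∈ G ↔ w ∈ fccStacking 1 (Real.sqrt (2 / 3)) := fun w => Iff.rfl
  -- the image is closed under integer combinations
  have himg_zsmul_add : ∀ (x y : EuclideanSpace ℝ (Fin 3)) (a : ℤ),
      x ∈ A₂ '' fccStacking 1 (Real.sqrt (2 / 3)) → y ∈ A₂ '' fccStacking 1 (Real.sqrt (2 / 3)) →
      (a : ℝ) • x + y ∈ A₂ '' fccStacking 1 (Real.sqrt (2 / 3)) := by
    rintro x y a ⟨p, hp, rfl⟩ ⟨q, hq, rfl⟩
    refine ⟨(a : ℝ) • p + q, ?_, by rw [map_add, LinearIsometryEquiv.map_smul]⟩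
    have hp' : p ∈ G := (hGmem p).2 hp
    have hq' : q ∈ G := (hGmem q).2 hq
    have : (a : ℝ) • p = a • p := by rw [Int.cast_smul_eq_zsmul]
    rw [← hGmem, this]
    exact G.add_mem (G.zsmul_mem hp' a) hq'
  -- pick a slot and its frame
  have hne : fccSlots.Nonempty := by
    rw [← Finset.card_pos, card_fccSlots]; norm_num
  obtain ⟨u, hu⟩ := hne
  obtain ⟨Ea, Eb, hEa, hEb, hdet, hframe, hgen⟩ := exists_frame_of_mem_fccSlots hu
  have h0 : (0 : EuclideanSpace ℝ (Fin 3)) ∈ fccStacking 1 (Real.sqrt (2 / 3)) :=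
    ⟨0, 0, 0, (barlowPos_zero _ _).symm⟩
  -- `Ea`, `Eb` are slots: lattice vectors of norm ≤ 1, nonzero by the determinant
  have slotOf : ∀ E : EuclideanSpace ℝ (Fin 3), ‖E‖ ≤ 1 → E ∈ fccStacking 1 (Real.sqrt (2 / 3)) → E ≠ 0 →
      E ∈ fccSlots := by
    intro E hE hEΛ hE0
    have h1 : 1 ≤ dist E 0 := le_dist_of_mem_barlowStacking_ideal isHaggSeq_const one_pos sqrt_twoThirds_sq
      hEΛ h0 hE0
    rw [dist_zero_right] at h1
    exact mem_fccSlots_of_unit hEΛ (le_antisymm hE h1)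
  have hEaΛ : Ea ∈ fccStacking 1 (Real.sqrt (2 / 3)) := by simpa using hframe 1 0 0
  have hEbΛ : Eb ∈ fccStacking 1 (Real.sqrt (2 / 3)) := by simpa using hframe 0 1 0
  have hEa0 : Ea ≠ 0 := by
    intro h0'
    have : Matrix.det ![WithLp.ofLp Ea, WithLp.ofLp Eb, WithLp.ofLp u] = 0 := by
      apply Matrix.det_eq_zero_of_row_eq_zero 0
      intro j; simp [h0']
    rw [this] at hdet; norm_num at hdet
  have hEb0 : Eb ≠ 0 := by
    intro h0'
    have : Matrix.det ![WithLp.ofLp Ea, WithLp.ofLp Eb, WithLp.ofLp u] = 0 := by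
      apply Matrix.det_eq_zero_of_row_eq_zero 1
      intro j; simp [h0']
    rw [this] at hdet; norm_num at hdet
  have hEaS := slotOf Ea hEa hEaΛ hEa0
  have hEbS := slotOf Eb hEb hEbΛ hEb0
  rintro _ ⟨q, hq, rfl⟩
  obtain ⟨a, b, τ, rfl⟩ := hgen q hq
  rw [map_add, map_add, LinearIsometryEquiv.map_smul, LinearIsometryEquiv.map_smul, LinearIsometryEquiv.map_smul]
  have hA0 : (0 : EuclideanSpace ℝ (Fin 3)) ∈ A₂ '' fccStacking 1 (Real.sqrt (2 / 3)) := ⟨0, h0, by simp⟩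
  have h3 := himg_zsmul_add (A₁ u) 0 τ (h u hu) hA0
  rw [add_zero] at h3
  have h2 := himg_zsmul_add (A₁ Eb) _ b (h Eb hEbS) h3
  have h1 := himg_zsmul_add (A₁ Ea) _ a (h Ea hEaS) h2
  rwa [← add_assoc] at h1

/-- **Non-co-axial grains have different slot sets** (both ways). -/
theorem slots_not_subset_of_not_coaxial
    (A₁ : EuclideanSpace ℝ (Fin 3) ≃ₗᵢ[ℝ] EuclideanSpace ℝ (Fin 3)) (t₁ : EuclideanSpace ℝ (Fin 3))
    (A₂ : EuclideanSpace ℝ (Fin 3) ≃ₗᵢ[ℝ] EuclideanSpace ℝ (Fin 3)) (t₂ : EuclideanSpace ℝ (Fin 3))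
    (hnc : ¬ ∃ (L : EuclideanSpace ℝ (Fin 3) ≃ₗᵢ[ℝ] EuclideanSpace ℝ (Fin 3))
        (s₁ s₂ : EuclideanSpace ℝ (Fin 3)) (σ σ' : ℤ → ℤ), IsHaggSeq σ ∧ IsHaggSeq σ' ∧
        (fun p => A₁ p + t₁) '' fccStacking 1 (Real.sqrt (2 / 3)) ⊆
          (fun p => L p + s₁) '' barlowStacking 1 (Real.sqrt (2 / 3)) σ ∧
        (fun p => A₂ p + t₂) '' fccStacking 1 (Real.sqrt (2 / 3)) ⊆
          (fun p => L p + s₂) '' barlowStacking 1 (Real.sqrt (2 / 3)) σ') :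
    (¬ ∀ w ∈ fccSlots, A₁ w ∈ A₂ '' fccStacking 1 (Real.sqrt (2 / 3))) ∧
      ¬ ∀ w ∈ fccSlots, A₂ w ∈ A₁ '' fccStacking 1 (Real.sqrt (2 / 3)) := by
  constructor
  · intro h
    exact hnc (coaxial_of_subset_frame A₁ A₂ A₂ t₁ t₂ constHagg constHagg isHaggSeq_const isHaggSeq_const
      (image_fcc_subset_of_slots_mem A₁ A₂ h) subset_rfl)
  · intro h
    exact hnc (coaxial_of_subset_frame A₁ A₂ A₁ t₁ t₂ constHagg constHagg isHaggSeq_const isHaggSeq_const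
      subset_rfl (image_fcc_subset_of_slots_mem A₂ A₁ h))

open scoped Classical in
/-- **The general-filling rung modulo twin caps, with the stub's non-co-axiality hypothesis.** -/
theorem general_twoSlabAdhesion_modulo_twinCaps_of_not_coaxial {δ : ℝ} (hg : KissingGap δ)
    (hc : KissingClassification δ)
    (A₁ : EuclideanSpace ℝ (Fin 3) ≃ₗᵢ[ℝ] EuclideanSpace ℝ (Fin 3)) (t₁ : EuclideanSpace ℝ (Fin 3))
    (A₂ : EuclideanSpace ℝ (Fin 3) ≃ₗᵢ[ℝ] EuclideanSpace ℝ (Fin 3)) (t₂ : EuclideanSpace ℝ (Fin 3))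
    (hnc : ¬ ∃ (L : EuclideanSpace ℝ (Fin 3) ≃ₗᵢ[ℝ] EuclideanSpace ℝ (Fin 3))
        (s₁ s₂ : EuclideanSpace ℝ (Fin 3)) (σ σ' : ℤ → ℤ), IsHaggSeq σ ∧ IsHaggSeq σ' ∧
        (fun p => A₁ p + t₁) '' fccStacking 1 (Real.sqrt (2 / 3)) ⊆
          (fun p => L p + s₁) '' barlowStacking 1 (Real.sqrt (2 / 3)) σ ∧
        (fun p => A₂ p + t₂) '' fccStacking 1 (Real.sqrt (2 / 3)) ⊆
          (fun p => L p + s₂) '' barlowStacking 1 (Real.sqrt (2 / 3)) σ')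
    {u₁ : EuclideanSpace ℝ (Fin 3)} (hu₁ : u₁ ∈ fccSlots)
    (hsteep₁ : Real.sqrt 2 / 2 ≤ ⟪A₁ u₁, EuclideanSpace.single (2 : Fin 3) (1 : ℝ)⟫_ℝ)
    {u₂ : EuclideanSpace ℝ (Fin 3)} (hu₂ : u₂ ∈ fccSlots)
    (hsteep₂ : ⟪A₂ u₂, EuclideanSpace.single (2 : Fin 3) (1 : ℝ)⟫_ℝ ≤ -(Real.sqrt 2 / 2)) :
    ∃ C R₀ : ℝ, 1 ≤ R₀ ∧ ∀ h : ℝ, 0 ≤ h → ∀ ρ : ℝ, R₀ ≤ ρ →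
      ∀ X P₁ P₂ : Finset (EuclideanSpace ℝ (Fin 3)),
      (∀ p ∈ X, ∀ q ∈ X, p ≠ q → 1 ≤ dist p q) → P₁ ⊆ X → P₂ ⊆ X \ P₁ →
      (∀ p ∈ X, -(2 * R₀) ≤ p 2 ∧ p 2 ≤ h + 2 * R₀ ∧ p 0 ^ 2 + p 1 ^ 2 ≤ ρ ^ 2) →
      (∀ p, p ∈ P₁ ↔ (p ∈ (fun q => A₁ q + t₁) '' fccStacking 1 (Real.sqrt (2 / 3)) ∧
        -(2 * R₀) ≤ p 2 ∧ p 2 ≤ -R₀ ∧ p 0 ^ 2 + p 1 ^ 2 ≤ ρ ^ 2)) →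
      (∀ p, p ∈ P₂ ↔ (p ∈ (fun q => A₂ q + t₂) '' fccStacking 1 (Real.sqrt (2 / 3)) ∧
        h + R₀ ≤ p 2 ∧ p 2 ≤ h + 2 * R₀ ∧ p 0 ^ 2 + p 1 ^ 2 ≤ ρ ^ 2)) →
      -- CLEAN outer slivers
      (∀ p ∈ X, p 2 < -(2 * R₀) + 1 → p ∈ (fun q => A₁ q + t₁) '' fccStacking 1 (Real.sqrt (2 / 3))) →
      (∀ p ∈ X, h + 2 * R₀ - 1 < p 2 → p ∈ (fun q => A₂ q + t₂) '' fccStacking 1 (Real.sqrt (2 / 3))) →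
      ((((P₁ ×ˢ (X \ P₁)).filter fun pq => dist pq.1 pq.2 = 1).card : ℕ) : ℝ) +
        ((((P₂ ×ˢ ((X \ P₁) \ P₂)).filter fun pq => dist pq.1 pq.2 = 1).card : ℕ) : ℝ) ≤
        contactDeficiency ((X \ P₁) \ P₂) +
          (Real.sqrt 2 / 4 * ∑ᶠ w ∈ {w ∈ fccStacking 1 (Real.sqrt (2 / 3)) | ‖w‖ = 1},
              |⟪w, A₁.symm (EuclideanSpace.single (2 : Fin 3) (1 : ℝ))⟫_ℝ| +
            Real.sqrt 2 / 4 * ∑ᶠ w ∈ {w ∈ fccStacking 1 (Real.sqrt (2 / 3)) | ‖w‖ = 1},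
              |⟪w, A₂.symm (EuclideanSpace.single (2 : Fin 3) (1 : ℝ))⟫_ℝ| - 1 / 3770) * Real.pi * ρ ^ 2 +
          (((((X.filter fun e => e - A₁ u₁ ∈ X ∧ (∀ w ∈ fccSlots, e - A₁ u₁ + A₁ w ∈ X) ∧
                ∃ v ∈ fccSlots, e + A₁ v ∉ X).filter fun e => ∃ n : EuclideanSpace ℝ (Fin 3), ‖n‖ = 1 ∧
              (∀ w ∈ fccSlots, ⟪A₁ w, n⟫_ℝ = 0 ∨ ⟪A₁ w, n⟫_ℝ = Real.sqrt (2 / 3) ∨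
                ⟪A₁ w, n⟫_ℝ = -Real.sqrt (2 / 3)) ∧
              ⟪A₁ u₁, n⟫_ℝ = Real.sqrt (2 / 3) ∧
              (∀ w ∈ fccSlots, ⟪A₁ w, n⟫_ℝ ≤ 0 → e + A₁ w ∈ X) ∧
              (∀ w ∈ fccSlots, 0 < ⟪A₁ w, n⟫_ℝ → e + A₁ w ∉ X ∧ e - A₁ w + (2 * ⟪A₁ w, n⟫_ℝ) • n ∈ X)).card
              : ℕ) : ℝ) +
           ((((X.filter fun e => e - A₂ u₂ ∈ X ∧ (∀ w ∈ fccSlots, e - A₂ u₂ + A₂ w ∈ X) ∧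
                ∃ v ∈ fccSlots, e + A₂ v ∉ X).filter fun e => ∃ n : EuclideanSpace ℝ (Fin 3), ‖n‖ = 1 ∧
              (∀ w ∈ fccSlots, ⟪A₂ w, n⟫_ℝ = 0 ∨ ⟪A₂ w, n⟫_ℝ = Real.sqrt (2 / 3) ∨
                ⟪A₂ w, n⟫_ℝ = -Real.sqrt (2 / 3)) ∧
              ⟪A₂ u₂, n⟫_ℝ = Real.sqrt (2 / 3) ∧
              (∀ w ∈ fccSlots, ⟪A₂ w, n⟫_ℝ ≤ 0 → e + A₂ w ∈ X) ∧
              (∀ w ∈ fccSlots, 0 < ⟪A₂ w, n⟫_ℝ → e + A₂ w ∉ X ∧ e - A₂ w + (2 * ⟪A₂ w, n⟫_ℝ) • n ∈ X)).card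
              : ℕ) : ℝ)) / 7540 +
          C * (1 + h) * ρ := by
  obtain ⟨h₁, h₂⟩ := slots_not_subset_of_not_coaxial A₁ t₁ A₂ t₂ hnc
  exact general_twoSlabAdhesion_modulo_twinCaps hg hc A₁ t₁ A₂ t₂ h₁ h₂ hu₁ hsteep₁ hu₂ hsteep₂

end Summit.Ventures.Crystal3D.Theorems

end
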